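import Summits.QuantumFields.YangMills.Theorems.BalabanLadderIRTwistedSlabColourDeterminant
import Summits.QuantumFields.YangMills.Theorems.BalabanLadderIRTwistedSlabTheNumber
import Summits.QuantumFields.YangMills.Theorems.BalabanLadderIRTwistedSlabBoxPurity
import HarnessLib

/-!
# T1-BOX FOR `SU(N)`: the e-flux-projected twisted slab `ℓ × ℓ × L` is exponentially pure UNIFORMLY in `β ≥ β₀(ℓ, L)` and
# `t ≥ 1` — the tree-level spectrum `det_ℝ Δ_t = ∏_{p ≠ 0} ∏_q (2cosh(tω_{p,q}) − 2)` made explicit and fed to purity propagation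

HELPER toward stub **T1** `TwistedSlabAnchor` of LINE `twisted-slab-continuity` (crux `IRcof`, stmt-QuantumFields-26930, census row 43;
LEAD prover ym-ir-line-tsc-p1 g5; `--supports` the crux, `--as helper`).  Theorems only.  K31d = assembly of the T1-box programme:
* §1 ★★ `det_su_ladder_eq_prod_cosh` — THE NUMBER's real Gaussian determinant at the decorated twist-eating ladder of the box
  `n₀ × n₁ × n₂ × n₃`, in CLOSED FORM: `det_ℝ Δ = ∏_{p=(a,b)≠0} ∏_{q} (2cosh(n₃·ω_{p,q}) − 2)`, `ω_{p,q} = 2 arsinh(√λ_{p,q}∕2)`,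
  `λ_{p,q} = Σ_{μ<3} (2 − 2cos(θ_μ(p) + 2πq_μ∕n_μ))`, `θ₀ = −2πkb∕(Nn₀)`, `θ₁ = 2πka∕(Nn₁)`, `θ₂ = 0` ('t Hooft's fractional momenta) — K31c
  (blocks + real form) with lit-4 L29 `det_twistedTorusLaplacian_exp_time_untwisted`;
* §2 `ladderFreq_pos` — every frequency is `> 0` (from K29b `0 < det_ℝ Δ`: no number theory), `card_filter_suCenter_pow_eq_one` (`q = 1∕N`);
* §3 ★★★ `tendsto_projSlabDefect_tanh` — THE NUMBER as the harmonic purity defect: `projSlabDefect(β; ω^k, n, m+1, m₂+1, m₃+1) →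
  1 − ∏_{p,q} tanh²((m₃+1)ω_{p,q}∕2)` (`z^n = 1`);
* §4 ★★★★ `twistedSlabAnchor_box_su` — **T1 AT ONE BOX FOR `SU(N)`**: for `N ≥ 2`, `k` a unit (`z = ω^k·1` generates the centre), `z^n = 1`,
  `n ≥ 1`, and EVERY box `(m+1) × (m+1) × (m₂+1)`: `∃ β₀ c C, 0 < c ∧ ∀ β ≥ β₀, ∀ t ≥ 1, projSlabDefect(fund; β, z, n, m+1, m₂+1, t) ≤ C·e^{−ct}`
  — K35 `twistedSlabAnchor_box_of_tendsto` at ONE long time `t*` with `1 − ∏ tanh²(t*ω∕2) < 1∕2` (L29 `exists_forall_ge_one_sub_prod_tanh_sq_lt`).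

HONEST FRAMING: this is T1's conclusion box by box, uniformly in the coupling and in `t` (the wall «M3» of the memo is gone); `β₀` depends on the box
and NOTHING here is uniform in `L = m₂+1` (the admissible `t*` grows like `log L`) — T1 proper (`∃ β₀` before `∀ L`, M4: cluster expansion) remains
OPEN, 0∕1; nothing here proves `IRcof`, `IR`, or the Yang–Mills mass gap (Clay: NOT proved); R4 = `BalabanLadder.UV` only.
References: G. 't Hooft, NPB 153 (1979) §§4–5; M. García Pérez, A. González-Arroyo, M. Okawa, JHEP 10 (2017) 150 §2.3–§2.5; IJMPA 29 (2014) 1445001 §3.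
-/

set_option autoImplicit false

noncomputable section

open scoped Matrix BigOperators Topology
open Finset Filter Complex
open Literature.MathematicalPhysics.QuantumFieldTheory Literature.MathematicalPhysics.QuantumLattice
open Literature.Analysis.OperatorTheory
open Literature.Analysis.Matrix.TwistedCycleLaplacian
open Literature.Combinatorics.SimpleGraph (cycleAngle)

namespace Summit.QuantumFields.YangMills.Cruxes.IRcof.TwistedSlab

variable {N : ℕ} [NeZero N]

/-! ## §1 The real Gaussian determinant of the ladder in closed form -/

section ClosedForm

variable {n₀ n₁ n₂ n₃ : ℕ} [NeZero n₀] [NeZero n₁] [NeZero n₂] [NeZero n₃] {k : ZMod N} {A B : Matrix.specialUnitaryGroup (Fin N) ℂ}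

omit [NeZero N] in
/-- `conj(ω^k) = e^{−2πik∕N}` as an exponential. [folklore] -/
theorem star_centerPhase_eq_exp (k : ZMod N) :
    star (centerPhase N k) = cexp ((-(2 * Real.pi * (k.val : ℝ) / N) : ℝ) * I) := by
  rw [centerPhase, Complex.star_def, ← Complex.exp_conj, map_mul, Complex.conj_ofReal, Complex.conj_I, Complex.ofReal_neg]
  ring_nf

/-- ★★ **THE NUMBER's determinant in closed form.**  At the decorated twist-eating ladder `![A, B, ω^i·1, ω^j·1]` (`B A B⁻¹ A⁻¹ = ω^k·1`, `k` a unit)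
of the box `n₀ × n₁ × n₂ × n₃`:
`det_ℝ Δ = ∏_{p = (a,b) ≠ 0} ∏_{q ∈ Fin n₀ × Fin n₁ × Fin n₂} (2cosh(n₃·ω_{p,q}) − 2)`, `ω_{p,q} = 2 arsinh(√λ_{p,q}∕2)`,
`λ_{p,q} = (2 − 2cos(θ₀ + 2πq₀∕n₀)) + ((2 − 2cos(θ₁ + 2πq₁∕n₁)) + (2 − 2cos(0 + 2πq₂∕n₂)))`, `θ₀ = −(2πk∕N)·b∕n₀`, `θ₁ = (2πk∕N)·a∕n₁` — one harmonic
time-circle determinant per colour momentum `p` and spatial momentum `q`, the momenta in direction `0,1` shifted by 't Hooft's fractions `b∕N`, `a∕N`.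
[cite: GarciaperezGonzalezarroyoOkawa2017, §2.3–§2.5] [cite: GarciaperezGonzalezarroyoOkawa2014, §3] -/
theorem det_su_ladder_eq_prod_cosh (hk : IsUnit k) (hAB : B * A * B⁻¹ * A⁻¹ = (suCenter N k : Matrix.specialUnitaryGroup (Fin N) ℂ))
    (i j : ZMod N) :
    LinearMap.det (DiscreteWeitzenboeck.covLaplacian
        (suD (fun e => Matrix.specialUnitaryGroup_le_unitaryGroup
          (ladderFieldPair_mem_specialUnitaryGroup (n₀ := n₀) (n₁ := n₁) (n₂ := n₂) (n₃ := n₃) A B i j e)))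
        (suDadj (fun e => Matrix.specialUnitaryGroup_le_unitaryGroup
          (ladderFieldPair_mem_specialUnitaryGroup (n₀ := n₀) (n₁ := n₁) (n₂ := n₂) (n₃ := n₃) A B i j e)))) =
      ∏ p : {p : Fin N × Fin N // p ≠ (0, 0)}, ∏ q : Fin n₀ × Fin n₁ × Fin n₂,
        (2 * Real.cosh (n₃ * (2 * Real.arsinh (Real.sqrt
          ((2 - 2 * Real.cos (-(2 * Real.pi * (k.val : ℝ) / N) * (p.1.2 : ℕ) / n₀ + cycleAngle n₀ q.1)) +
            ((2 - 2 * Real.cos ((2 * Real.pi * (k.val : ℝ) / N) * (p.1.1 : ℕ) / n₁ + cycleAngle n₁ q.2.1)) +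
              (2 - 2 * Real.cos (0 + cycleAngle n₂ q.2.2)))) / 2))) - 2) := by
  set φ : ℝ := -(2 * Real.pi * (k.val : ℝ) / N) with hφ
  have hω := isPrimitiveRoot_star_centerPhase (N := N) hk
  have hAB' := coe_mul_eq_smul_of_commutator_eq hAB
  have hωexp : star (centerPhase N k) = cexp ((φ : ℝ) * I) := star_centerPhase_eq_exp k
  have hAu : (A : Matrix (Fin N) (Fin N) ℂ) ∈ Matrix.unitaryGroup (Fin N) ℂ := Matrix.specialUnitaryGroup_le_unitaryGroup A.2
  have hBu : (B : Matrix (Fin N) (Fin N) ℂ) ∈ Matrix.unitaryGroup (Fin N) ℂ := Matrix.specialUnitaryGroup_le_unitaryGroup B.2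
  set hU := fun e => Matrix.specialUnitaryGroup_le_unitaryGroup
    (ladderFieldPair_mem_specialUnitaryGroup (n₀ := n₀) (n₁ := n₁) (n₂ := n₂) (n₃ := n₃) A B i j e) with hUdef
  -- the uniformising phases
  set θ₀ : {p : Fin N × Fin N // p ≠ (0, 0)} → ℝ := fun p => φ * (p.1.2 : ℕ) / n₀ with hθ₀
  set θ₁ : {p : Fin N × Fin N // p ≠ (0, 0)} → ℝ := fun p => -φ * (p.1.1 : ℕ) / n₁ with hθ₁
  have hn₀ : (n₀ : ℂ) ≠ 0 := Nat.cast_ne_zero.2 (NeZero.ne n₀)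
  have hn₁ : (n₁ : ℂ) ≠ 0 := Nat.cast_ne_zero.2 (NeZero.ne n₁)
  have h₀ : ∀ p : {p : Fin N × Fin N // p ≠ (0, 0)}, cexp ((θ₀ p : ℝ) * I) ^ n₀ = star (centerPhase N k) ^ (p.1.2 : ℕ) := by
    intro p
    rw [hωexp, ← Complex.exp_nat_mul, ← Complex.exp_nat_mul]
    congr 1
    simp only [hθ₀]
    push_cast
    field_simp
  have h₁ : ∀ p : {p : Fin N × Fin N // p ≠ (0, 0)}, cexp ((θ₁ p : ℝ) * I) ^ n₁ = (star (centerPhase N k) ^ (p.1.1 : ℕ))⁻¹ := by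
    intro p
    rw [hωexp, ← Complex.exp_nat_mul, ← Complex.exp_nat_mul, ← Complex.exp_neg]
    congr 1
    simp only [hθ₁]
    push_cast
    field_simp
  -- blocks over colour momenta, each a twisted torus Laplacian with the time direction untwisted
  have hblocks := det_covLaplacian_traceless_ladder_eq_prod (n₀ := n₀) (n₁ := n₁) (n₂ := n₂) (n₃ := n₃) hAu hBu hω hAB'
    (star_centerPhase_mul_self i) (star_centerPhase_mul_self j) (fun p => cexp ((θ₀ p : ℝ) * I)) (fun p => cexp ((θ₁ p : ℝ) * I)) h₀ h₁ hU
  have hreal := det_covLaplacian_traceless_eq_ofReal_det_su (n₀ := n₀) (n₁ := n₁) (n₂ := n₂) (n₃ := n₃) hU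
  have hfac : ∀ p : {p : Fin N × Fin N // p ≠ (0, 0)},
      (twistedTorusLaplacian n₀ n₁ n₂ n₃ ![cexp ((θ₀ p : ℝ) * I), cexp ((θ₁ p : ℝ) * I), 1, 1]).det =
        ((∏ q : Fin n₀ × Fin n₁ × Fin n₂, (2 * Real.cosh (n₃ * (2 * Real.arsinh (Real.sqrt
          ((2 - 2 * Real.cos (θ₀ p + cycleAngle n₀ q.1)) + ((2 - 2 * Real.cos (θ₁ p + cycleAngle n₁ q.2.1)) +
            (2 - 2 * Real.cos (0 + cycleAngle n₂ q.2.2)))) / 2))) - 2) : ℝ) : ℂ) := by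
    intro p
    have h1 : (![cexp ((θ₀ p : ℝ) * I), cexp ((θ₁ p : ℝ) * I), 1, 1] : Fin 4 → ℂ) =
        ![cexp ((θ₀ p : ℝ) * I), cexp ((θ₁ p : ℝ) * I), cexp (((0 : ℝ) : ℂ) * I), 1] := by
      rw [Complex.ofReal_zero, zero_mul, Complex.exp_zero]
    rw [h1, det_twistedTorusLaplacian_exp_time_untwisted]
  rw [hreal, Finset.prod_congr rfl fun p _ => hfac p, ← Complex.ofReal_prod] at hblocks
  have h := Complex.ofReal_injective hblocks
  rw [h]
  simp only [hθ₀, hθ₁, hφ, neg_neg]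

end ClosedForm

/-! ## §2 Positivity of the frequencies and the projection's normalisation -/

section Freq

variable {m m₂ : ℕ} {k : ZMod N} {A B : Matrix.specialUnitaryGroup (Fin N) ℂ}

/-- **Every tree-level frequency of the twisted slab is positive** (`p ≠ 0`): `ω_{p,q} > 0` for all colour momenta `p` and spatial momenta `q` of
the box `(m+1) × (m+1) × (m₂+1)` — read off `0 < det_ℝ Δ` (K29b) at time extent `1` through §1 (each factor `2cosh ω − 2 ≥ 0`, none vanishes): the
twist leaves NO ZERO MODE. [cite: GarciaperezGonzalezarroyoOkawa2014, §3 («momentum quantized in units of `2π∕(Nl)` … excluding zero»)] -/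
theorem ladderFreq_pos (hk : IsUnit k) (hAB : B * A * B⁻¹ * A⁻¹ = (suCenter N k : Matrix.specialUnitaryGroup (Fin N) ℂ))
    (hNm : 2 ≤ N * (m + 1)) (p : {p : Fin N × Fin N // p ≠ (0, 0)}) (q : Fin (m + 1) × Fin (m + 1) × Fin (m₂ + 1)) :
    0 < 2 * Real.arsinh (Real.sqrt
          ((2 - 2 * Real.cos (-(2 * Real.pi * (k.val : ℝ) / N) * (p.1.2 : ℕ) / (m + 1 : ℕ) + cycleAngle (m + 1) q.1)) +
            ((2 - 2 * Real.cos ((2 * Real.pi * (k.val : ℝ) / N) * (p.1.1 : ℕ) / (m + 1 : ℕ) + cycleAngle (m + 1) q.2.1)) +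
              (2 - 2 * Real.cos (0 + cycleAngle (m₂ + 1) q.2.2)))) / 2) := by
  have hdet := det_covLaplacian_ladder_pos (m₂ := m₂) (m₃ := 0) hk hAB hNm 0 0
  rw [det_su_ladder_eq_prod_cosh (n₀ := m + 1) (n₁ := m + 1) (n₂ := m₂ + 1) (n₃ := 0 + 1) hk hAB 0 0] at hdet
  -- every factor is `≥ 0`; the product is `> 0`, so no factor vanishes
  set ω : {p : Fin N × Fin N // p ≠ (0, 0)} → (Fin (m + 1) × Fin (m + 1) × Fin (m₂ + 1)) → ℝ := fun p q =>
    2 * Real.arsinh (Real.sqrt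
      ((2 - 2 * Real.cos (-(2 * Real.pi * (k.val : ℝ) / N) * (p.1.2 : ℕ) / (m + 1 : ℕ) + cycleAngle (m + 1) q.1)) +
        ((2 - 2 * Real.cos ((2 * Real.pi * (k.val : ℝ) / N) * (p.1.1 : ℕ) / (m + 1 : ℕ) + cycleAngle (m + 1) q.2.1)) +
          (2 - 2 * Real.cos (0 + cycleAngle (m₂ + 1) q.2.2)))) / 2) with hωdef
  have hω0 : ∀ p q, 0 ≤ ω p q := fun p q => by
    simp only [hωdef]
    exact mul_nonneg zero_le_two (Real.arsinh_nonneg_iff.2 (by positivity))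
  have hfac0 : ∀ p q, 0 ≤ 2 * Real.cosh (((0 + 1 : ℕ) : ℝ) * ω p q) - 2 := fun p q => by
    have := Real.one_le_cosh (((0 + 1 : ℕ) : ℝ) * ω p q); linarith
  have hne : 2 * Real.cosh (((0 + 1 : ℕ) : ℝ) * ω p q) - 2 ≠ 0 := by
    intro h0
    have hz : ∏ p' : {p : Fin N × Fin N // p ≠ (0, 0)}, ∏ q' : Fin (m + 1) × Fin (m + 1) × Fin (m₂ + 1),
        (2 * Real.cosh (((0 + 1 : ℕ) : ℝ) * ω p' q') - 2) = 0 :=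
      Finset.prod_eq_zero (Finset.mem_univ p) (Finset.prod_eq_zero (Finset.mem_univ q) h0)
    exact hdet.ne' hz
  have hωne : ω p q ≠ 0 := by
    intro h0
    apply hne
    rw [h0, mul_zero, Real.cosh_zero]; ring
  exact lt_of_le_of_ne (hω0 p q) (Ne.symm hωne)

/-- **The projection's normalisation `q = 1∕N`**: for a generator `z = ω^k·1` of the centre (`k` a unit, `N ≥ 1`) and `z^n = 1`, `n ≥ 1`:
`N · (n⁻¹ · #{j < n : z^j = 1}) = 1` (the `j` with `z^j = 1` are the multiples of `N` below `n`, and `N ∣ n`). [cite: tHooft1979Flux, §5 (5.2)] -/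
theorem card_filter_suCenter_pow_eq_one (hk : IsUnit k) {n : ℕ} (hn : 0 < n)
    (hzn : (suCenter N k : Matrix.specialUnitaryGroup (Fin N) ℂ) ^ n = 1) :
    (N : ℝ) * ((n : ℝ)⁻¹ * ((Finset.univ.filter fun j : Fin n =>
        (suCenter N k : Matrix.specialUnitaryGroup (Fin N) ℂ) ^ (j : ℕ) = 1).card : ℝ)) = 1 := by
  have hord := orderOf_suCenter (N := N) hk
  have hNn : N ∣ n := by rw [← hord]; exact orderOf_dvd_of_pow_eq_one hzn
  have hN0 : 0 < N := Nat.pos_of_ne_zero (NeZero.ne N)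
  -- the filter is the set of multiples of `N` below `n`
  have hcard : (Finset.univ.filter fun j : Fin n => (suCenter N k : Matrix.specialUnitaryGroup (Fin N) ℂ) ^ (j : ℕ) = 1).card = n / N := by
    have h1 : (Finset.univ.filter fun j : Fin n => (suCenter N k : Matrix.specialUnitaryGroup (Fin N) ℂ) ^ (j : ℕ) = 1) =
        Finset.univ.filter fun j : Fin n => N ∣ (j : ℕ) := by
      refine Finset.filter_congr fun j _ => ?_
      have h := orderOf_dvd_iff_pow_eq_one (x := (suCenter N k : Matrix.specialUnitaryGroup (Fin N) ℂ)) (n := (j : ℕ))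
      rw [hord] at h
      exact h.symm
    rw [h1]
    -- count via the embedding `Fin n ↪ ℕ`
    have h2 : ((Finset.univ.filter fun j : Fin n => N ∣ (j : ℕ)).map Fin.valEmbedding) =
        (Finset.range (n / N)).image (fun i => i * N) := by
      ext x
      simp only [Finset.mem_map, Finset.mem_filter, Finset.mem_univ, true_and, Fin.valEmbedding_apply, Finset.mem_image,
        Finset.mem_range]
      constructor
      · rintro ⟨j, hj, rfl⟩
        obtain ⟨c, hc⟩ := hj
        refine ⟨c, ?_, by rw [hc, mul_comm]⟩
        have : c * N < n / N * N := by rw [Nat.div_mul_cancel hNn, mul_comm, ← hc]; exact j.2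
        exact Nat.lt_of_mul_lt_mul_right this
      · rintro ⟨c, hc, rfl⟩
        have hlt : c * N < n := by
          calc c * N < n / N * N := Nat.mul_lt_mul_of_pos_right hc hN0
            _ = n := Nat.div_mul_cancel hNn
        exact ⟨⟨c * N, hlt⟩, ⟨c, by simp [mul_comm]⟩, rfl⟩
    rw [← Finset.card_map Fin.valEmbedding, h2, Finset.card_image_of_injective _ (mul_left_injective₀ hN0.ne'), Finset.card_range]
  rw [hcard]
  have hn0 : (n : ℝ) ≠ 0 := Nat.cast_ne_zero.2 hn.ne'
  have hN0' : (N : ℝ) ≠ 0 := Nat.cast_ne_zero.2 hN0.ne'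
  rw [Nat.cast_div hNn hN0']
  field_simp

end Freq

/-! ## §3 THE NUMBER as the harmonic purity defect -/

section Limit

variable {m m₂ m₃ : ℕ} {k : ZMod N} {A B : Matrix.specialUnitaryGroup (Fin N) ℂ}

/-- ★★★ **THE NUMBER, explicit**: for `z = ω^k·1` (`k` a unit, `N ≥ 2`), `z^n = 1`, `n ≥ 1`, and a twist-eating pair,
`projSlabDefect(fund; β, z, n, m+1, m₂+1, m₃+1) → 1 − ∏_{p ≠ 0} ∏_q tanh²((m₃+1)·ω_{p,q}∕2)` as `β → ∞` — one minus the purity of the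
thermal state of `3·#sites·(N²−1)` harmonic modes, exactly the g2 `harmonicDefect` shape (`…TwistedSlabHarmonicDefect`).
[cite: tHooft1979Flux, §5 (5.1)–(5.4)] [cite: GarciaperezGonzalezarroyoOkawa2017, §2.5] -/
theorem tendsto_projSlabDefect_tanh (hN : 2 ≤ N) (hk : IsUnit k) {n : ℕ} (hn : 0 < n)
    (hzn : (suCenter N k : Matrix.specialUnitaryGroup (Fin N) ℂ) ^ n = 1)
    (hAB : B * A * B⁻¹ * A⁻¹ = (suCenter N k : Matrix.specialUnitaryGroup (Fin N) ℂ)) :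
    Tendsto (fun β : ℝ => projSlabDefect (fundamentalRep (Fin N)) β (suCenter N k : Matrix.specialUnitaryGroup (Fin N) ℂ) n
        (m + 1) (m₂ + 1) (m₃ + 1)) atTop
      (𝓝 (1 - ∏ p : {p : Fin N × Fin N // p ≠ (0, 0)}, ∏ q : Fin (m + 1) × Fin (m + 1) × Fin (m₂ + 1),
        Real.tanh (((m₃ + 1 : ℕ) : ℝ) * (2 * Real.arsinh (Real.sqrt
          ((2 - 2 * Real.cos (-(2 * Real.pi * (k.val : ℝ) / N) * (p.1.2 : ℕ) / (m + 1 : ℕ) + cycleAngle (m + 1) q.1)) +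
            ((2 - 2 * Real.cos ((2 * Real.pi * (k.val : ℝ) / N) * (p.1.1 : ℕ) / (m + 1 : ℕ) + cycleAngle (m + 1) q.2.1)) +
              (2 - 2 * Real.cos (0 + cycleAngle (m₂ + 1) q.2.2)))) / 2)) / 2) ^ 2)) := by
  have h := tendsto_projSlabDefect_closedForm (m := m) (m₂ := m₂) (m₃ := m₃) hN hk hn hAB
  rw [det_su_ladder_eq_prod_cosh (n₀ := m + 1) (n₁ := m + 1) (n₂ := m₂ + 1) (n₃ := m₃ + 1) hk hAB 0 0,
    det_su_ladder_eq_prod_cosh (n₀ := m + 1) (n₁ := m + 1) (n₂ := m₂ + 1) (n₃ := 2 * m₃ + 1 + 1) hk hAB 0 0,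
    card_filter_suCenter_pow_eq_one hk hn hzn, one_mul] at h
  have hc : ((2 * m₃ + 1 + 1 : ℕ) : ℝ) = 2 * ((m₃ + 1 : ℕ) : ℝ) := by push_cast; ring
  simp only [hc] at h
  convert h using 3
  rw [← Fintype.prod_prod_type', ← Fintype.prod_prod_type', ← Fintype.prod_prod_type']
  exact (prod_two_cosh_sub_two_sq_div (((m₃ + 1 : ℕ) : ℝ)) _).symm

end Limit

/-! ## §4 T1 AT ONE BOX FOR `SU(N)`, UNIFORMLY IN THE COUPLING -/

section Main

variable {k : ZMod N}

/-- ★★★★ **T1-BOX FOR `SU(N)`.**  For `N ≥ 2`, a generator `z = ω^k·1` of the centre (`k` a unit of `ℤ∕N`), `n ≥ 1` with `z^n = 1`, and EVERY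
box `(m+1) × (m+1) × (m₂+1)`: there are `β₀`, `c > 0`, `C ≥ 0` with
`projSlabDefect(fund; β, z, n, m+1, m₂+1, t) ≤ C·e^{−ct}` for ALL `β ≥ β₀` and ALL `t ≥ 1` — the e-flux-projected twisted slab is
exponentially pure UNIFORMLY IN THE COUPLING.  Mechanism: the transfer-matrix trace has integer multiplicities (K33∕K35), THE NUMBER
(K30b) is `1 − ∏ tanh²(tω∕2)` (§3) with every `ω > 0` (§2), hence `< 1∕2` at one long time `t*` (lit-4 L29), and purity at one time propagates
(K34∕K35).  HONEST: `β₀, c, C` depend on the box (`t* ∼ log L`); T1 (uniform in `L`) is NOT proved. [cite: tHooft1979Flux, §5 (5.1)–(5.4)]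
[cite: GarciaperezGonzalezarroyoOkawa2014, §3] -/
theorem twistedSlabAnchor_box_su (hN : 2 ≤ N) (hk : IsUnit k) {n : ℕ} (hn : 0 < n)
    (hzn : (suCenter N k : Matrix.specialUnitaryGroup (Fin N) ℂ) ^ n = 1) (m m₂ : ℕ) :
    ∃ β₀ c C : ℝ, 0 < c ∧ 0 ≤ C ∧ ∀ β : ℝ, β₀ ≤ β → ∀ t : ℕ, 1 ≤ t →
      projSlabDefect (fundamentalRep (Fin N)) β (suCenter N k : Matrix.specialUnitaryGroup (Fin N) ℂ) n (m + 1) (m₂ + 1) t ≤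
        C * Real.exp (-(c * (t : ℝ))) := by
  -- a twist-eating pair
  obtain ⟨⟨A', B', hAB'⟩, -, -⟩ := hasIsolatingTwist_suCenter (N := N) hk
  have hNm : 2 ≤ N * (m + 1) := le_trans hN (Nat.le_mul_of_pos_right N (Nat.succ_pos m))
  -- the frequencies and ONE long time at which the harmonic defect is `< 1/2`
  set ω : {p : Fin N × Fin N // p ≠ (0, 0)} × (Fin (m + 1) × Fin (m + 1) × Fin (m₂ + 1)) → ℝ := fun pq =>
    2 * Real.arsinh (Real.sqrt
      ((2 - 2 * Real.cos (-(2 * Real.pi * (k.val : ℝ) / N) * (pq.1.1.2 : ℕ) / (m + 1 : ℕ) + cycleAngle (m + 1) pq.2.1)) +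
        ((2 - 2 * Real.cos ((2 * Real.pi * (k.val : ℝ) / N) * (pq.1.1.1 : ℕ) / (m + 1 : ℕ) + cycleAngle (m + 1) pq.2.2.1)) +
          (2 - 2 * Real.cos (0 + cycleAngle (m₂ + 1) pq.2.2.2)))) / 2) with hωdef
  have hωpos : ∀ pq, 0 < ω pq := fun pq => ladderFreq_pos (m₂ := m₂) hk hAB' hNm pq.1 pq.2
  obtain ⟨t₀, ht₀⟩ := exists_forall_ge_one_sub_prod_tanh_sq_lt hωpos (ε := 1 / 2) one_half_pos
  set m₃ : ℕ := ⌈max t₀ 0⌉₊ + 1 with hm₃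
  have hts : 2 ≤ m₃ + 1 := by omega
  have hge : t₀ ≤ ((m₃ + 1 : ℕ) : ℝ) := by
    have h1 : max t₀ 0 ≤ (⌈max t₀ 0⌉₊ : ℝ) := Nat.le_ceil _
    have h2 : t₀ ≤ max t₀ 0 := le_max_left _ _
    push_cast [hm₃]
    linarith
  have hD := ht₀ _ hge
  -- THE NUMBER at that time, in harmonic form
  have hlim := tendsto_projSlabDefect_tanh (m := m) (m₂ := m₂) (m₃ := m₃) hN hk hn hzn hAB'
  have hval : (1 - ∏ p : {p : Fin N × Fin N // p ≠ (0, 0)}, ∏ q : Fin (m + 1) × Fin (m + 1) × Fin (m₂ + 1),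
        Real.tanh (((m₃ + 1 : ℕ) : ℝ) * (2 * Real.arsinh (Real.sqrt
          ((2 - 2 * Real.cos (-(2 * Real.pi * (k.val : ℝ) / N) * (p.1.2 : ℕ) / (m + 1 : ℕ) + cycleAngle (m + 1) q.1)) +
            ((2 - 2 * Real.cos ((2 * Real.pi * (k.val : ℝ) / N) * (p.1.1 : ℕ) / (m + 1 : ℕ) + cycleAngle (m + 1) q.2.1)) +
              (2 - 2 * Real.cos (0 + cycleAngle (m₂ + 1) q.2.2)))) / 2)) / 2) ^ 2) =
      1 - ∏ pq, Real.tanh (((m₃ + 1 : ℕ) : ℝ) * ω pq / 2) ^ 2 := by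
    rw [← Fintype.prod_prod_type']
  rw [hval] at hlim
  exact twistedSlabAnchor_box_of_tendsto (continuous_fundamentalRep (n := Fin N)) fundamentalRep_mem_unitaryGroup
    (suCenter N k).2 hn hzn (m + 1) (m₂ + 1) hts hD hlim

end Main

end Summit.QuantumFields.YangMills.Cruxes.IRcof.TwistedSlab

end
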